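import Summits.QuantumFields.YangMills.Theorems.UnitScaleTiltProp7PcolImpliesNSPoincare
import Summits.QuantumFields.YangMills.Theorems.UnitScaleTiltProp7HPcolNegLowMode
import Summits.QuantumFields.YangMills.Theorems.UnitScaleTiltProp7HPcolNegIrreducible
import Summits.QuantumFields.YangMills.Theorems.UnitScaleTiltProp7SectET3RealCoordSums
import Literature.MathematicalPhysics.QuantumFieldTheory.Balaban1983to89.T4PlaqDisjointFamilies
import HarnessLib

/-!
# NEG-hPcol N6 — THE HEADLINE (★★OWNER WORD 38 «GO», px12 g11; SPEC-0 e654b2a4 N6; LOCATE v2.1 8aced68d; TARGET.md footnote 17v): **UNDER THE DISPLAY'S OWN SIDE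
# CONDITIONS THE S42ᴸ ROW `hPcol` (pre-`Lift` text, ✓p729698 :185–188 VERBATIM) IS NOT INHABITABLE** — `theorem not_hPcol_S42L : ¬ (∀ L > 1, ∀ i U₀ ρ, RegPr ρ U₀ → ρ ≤ αcap L →
# ∀ bd E, Σ_x ‖(G′ᴾ R_S D* δ_{bd,E})(x)‖ ≤ p139 L · ‖E‖)`, for EVERY choice of the display's constants `αcap > 0`, `c₀, cB > 0`, `a > 0`, `p139`.

Cell `ym3-torus` (YM ladder rung R3 = continuum SU(2) Yang–Mills on T³ — a RUNG, NOT d = 4, NOT infinite volume, NOT a mass gap, NOT the Clay problem), width seat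
`ym3-torus-px12` (gen 11), crux of record `MinimiserStabilityRegPr` (stmt-QuantumFields-19200, route `UnitScaleTilt`).  THEOREMS ONLY (0 `def`, 0 `sorry`);
`--supports stmt-QuantumFields-19200 --as helper`, count-neutral.

THE ARGUMENT (the six pieces of px12 g11's NAMING LINE 18:30:32Z ∕ 18:41:38Z, assembled):
* the member: any `T3Family` `F` (here `L = 3`, `m = 1`), unit level `n = 0`, fine level `K = 1`, index `i = ⟨(F, 0, 1), rfl, 0 < 1⟩ : Idx F.L`; the background is px12's explicit
  stratum-(c) family `U_s(b) := expHerm ((s·θ((b.src)_{dir b} mod L)) • σ_{dir b})`, `θ = (1, −1, 0, …)`, at ONE small `s > 0` (below `1∕(40L)`, below the two (N3c) regularity windows,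
  below `1∕(12 (p⁺ + 1) L)`);
* (N3c) px13 g10 ✓`Prop7HPcolNegRegPr.regPr_field_of_le`: `U_s ∈ RegPr ρ` at `ρ = αcap L` (so the row's guard `RegPr ρ U₀ ∧ ρ ≤ αcap L` is met) and at `ε₀ = (10¹² L³)⁻¹`;
* (N3b) px12 g11 ✓`Prop7HPcolNegCommutatorLattice.spec_emlIterU_field_eq_one` (`Ū_sʲ ≡ 1`) + px13 g10 ✓`Prop7HPcolNegLowMode.holT_emb_field_eq` (one-block periodicity) feed
  (N4) px13 g10 ✓`Prop7HPcolNegConstantMode.toL2S_const_mem_NS`: the CONSTANT gauge parameter `λ ≡ σ₃` lies in `N_S(U_s)`, with `‖(D_{U_s} λ)(b)‖ ≤ 2‖U_s(b) − 1‖·L^{K−n}·‖σ₃‖ ≤ 2sL`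
  (✓`norm_toL2_symm_DL2_toL2S_const_le`, ✓`Prop7HPcolNegLowMode.norm_field_sub_one_le`);
* (N5) routeR-w3 g11 ✓`Prop7HPcolNegIrreducible.parallel_is_scalar`: `ker D_{U_s}` = the constant scalars, so (§1 here, ✓`Prop7SectET3RealCoordSums.inner_toL2S` + `tr σ₃ = 0`) `σ₃ ⊥ ker D_{U_s}` and `P₀(σ₃) = 0`;
* (P1) px12 g11 ✓`Prop7PcolImpliesNSPoincare.l1_sub_kerDProj_le_of_columns`: the row's column bounds force the ℓ¹-Poincaré inequality
  `Σ_x ‖λ(x) − P₀λ(x)‖ ≤ p139 L · Σ_b ‖(D_{U_s}λ)(b)‖` on `N_S(U_s)`; at `λ ≡ σ₃`: `#sites ≤ p139 L · (3·#sites) · 2sL ≤ #sites ∕ 2` — absurd (`#sites ≥ 1`).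

HONEST FRAMING.  `hPcol` is a display BINDER of the pre-`Lift` S42ᴸ text (✓p729698); this file is NEGATIVE KNOWLEDGE OF RECORD for TARGET.md footnote 17v — the intrinsic `R_S`-column
row is not inhabitable on stratum (c), which is WHY LIFT-THREAD 2 (the `Lift`-guarded S43ᴸT2 reshape) is the repair of record.  It is NOT an item refutation (no ledger statement is
negated: the row is a hypothesis of a display, not a thesis decl), NOT a display event, NOT progress on EX; nothing of EX ∕ the 13 print rows ∕ `hThm2S` ∕ 19200 ∕ any crux or rung
statement is proved here; the Yang–Mills mass gap is NOT proved.

References: T. Bałaban, CMP **99** (1985) 389–434 [Balaban1985BackgroundPropagators] ((3.11) p.392, (3.19)–(3.24) pp.393–394, Prop. 3.3 p.397); CMP **109** (1987) 249–301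
[Balaban1987RG1] ((0.1) p.251, (0.4) p.253); CMP **102** (1985) 277–309 [Balaban1985Variational] (Thm 1 p.279, (112) p.294); CMP **98** (1985) 17–51 [Balaban1985Averaging]
((18)–(19) p.21).
-/

set_option autoImplicit false

noncomputable section

open scoped BigOperators Matrix.Norms.L2Operator Matrix InnerProductSpace

namespace Summit.QuantumFields.YangMills.Theorems.Prop7HPcolRowS42LNotInhabitable

open Literature.MathematicalPhysics.QuantumFieldTheory.Balaban1983to89
open Literature.MathematicalPhysics.QuantumFieldTheory.Balaban1983to89.T3ContinuumYM3Torus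
open Literature.MathematicalPhysics.QuantumFieldTheory.Balaban1983to89.T3Thm1Carrier (Idx)
open Literature.MathematicalPhysics.QuantumFieldTheory.Balaban1983to89.T3PrintedRegularMinimiser (RegPr)
open Literature.MathematicalPhysics.QuantumFieldTheory.Balaban1983to89.T3SectALandauChart (bgUnits)
open Literature.MathematicalPhysics.QuantumLattice (spinHalfPauli)
open B11Eq103H1Complex (SiteL2K BondL2K)
open T4PlaqDisjointFamilies (card_pbond)
open Summit.QuantumFields.YangMills.Theorems.Prop7SectET3Transport (periodsT3)
open Summit.QuantumFields.YangMills.Theorems.Prop7SectET3HilbertLetters (W₂ toL2 toL2S DL2 DstarL2)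
open Summit.QuantumFields.YangMills.Theorems.Prop7SectET3RealCoordSums (inner_toL2S)
open Summit.QuantumFields.YangMills.Theorems.Prop7SectET3GaugeProjector (NS RS)
open Summit.QuantumFields.YangMills.Theorems.Prop7SectET3DeltaPiPInv (kerDProj GprimeP kerDProj_eq_zero_of_mem_orthogonal)
open Summit.QuantumFields.YangMills.Theorems.Prop7TPrint (expHermField)
open Summit.QuantumFields.YangMills.Theorems.Prop7PcolImpliesNSPoincare (l1_sub_kerDProj_le_of_columns)
open Summit.QuantumFields.YangMills.Theorems.Prop7HPcolNegPauliExp (norm_spinHalfPauli trace_spinHalfPauli)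
open Summit.QuantumFields.YangMills.Theorems.Prop7HPcolNegCommutatorLattice (spec_emlIterU_field_eq_one)
open Summit.QuantumFields.YangMills.Theorems.Prop7HPcolNegRegPr (regPr_field_of_le)
open Summit.QuantumFields.YangMills.Theorems.Prop7HPcolNegConstantMode (toL2S_const_mem_NS norm_toL2_symm_DL2_toL2S_const_le)
open Summit.QuantumFields.YangMills.Theorems.Prop7HPcolNegLowMode (holT_emb_field_eq norm_field_sub_one_le)
open Summit.QuantumFields.YangMills.Theorems.Prop7HPcolNegIrreducible (parallel_is_scalar)

/-! ## §1 Letters: `σ₃ ⊥ ker D_{U_s}` (so `P₀ σ₃ = 0`) and the two sides of the ℓ¹-Poincaré inequality at a constant `λ ≡ c` -/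

variable {F : T3Family} {K : ℕ} {c₀ : ℝ}

/-- **A TRACELESS CONSTANT IS ORTHOGONAL TO `ker D_{U_s}`** (`0 < s ≤ 1`): by routeR-w3 g11's (N5) ✓`Prop7HPcolNegIrreducible.parallel_is_scalar` the covariantly constant gauge
parameters of the commutator lattice are the constant SCALARS `z·1`, and `⟪z·1, c⟫ = c₀ · Σ_x z̄ · tr c = 0`. [cite: Balaban1985BackgroundPropagators, (3.21)–(3.24) p.394] -/
theorem toL2S_const_mem_ker_DL2_orthogonal (n : ℕ) [Fact (0 < c₀)] (s : ℝ) (hs0 : 0 < s) (hs : s ≤ 1) (c : Matrix (Fin 2) (Fin 2) ℂ) (hc : c.trace = 0) :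
    toL2S F K c₀ (fun _ => c) ∈ (LinearMap.ker (DL2 F n K c₀ (expHermField (F := F) (K := K)
      (fun b : PBond (F.P K) 0 =>
        (((s * (if (b.src b.dir).val % F.L = 0 then (1 : ℝ) else if (b.src b.dir).val % F.L = 1 then -1 else 0)) : ℝ) : ℂ) •
          spinHalfPauli b.dir))))ᗮ := by
  rw [Submodule.mem_orthogonal]
  intro u hu
  obtain ⟨z, hz⟩ := parallel_is_scalar F K n c₀ s hs0 hs ((toL2S F K c₀).symm u)
    (by rw [LinearEquiv.apply_symm_apply]; exact LinearMap.mem_ker.1 hu)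
  have hu' : u = toL2S F K c₀ (fun _ => z • (1 : Matrix (Fin 2) (Fin 2) ℂ)) := by
    rw [← hz, LinearEquiv.apply_symm_apply]
  rw [hu', inner_toL2S]
  simp [Matrix.trace_smul, hc]

/-- **`P₀(U_s) c = 0` FOR A TRACELESS CONSTANT `c`** (`0 < s ≤ 1`): the orthogonal projection onto `ker D_{U_s}` kills the orthogonal complement
(✓`Prop7SectET3DeltaPiPInv.kerDProj_eq_zero_of_mem_orthogonal`). [cite: Balaban1985BackgroundPropagators, (3.21)–(3.24) p.394] -/
theorem kerDProj_toL2S_const_eq_zero (n : ℕ) [Fact (0 < c₀)] (s : ℝ) (hs0 : 0 < s) (hs : s ≤ 1) (c : Matrix (Fin 2) (Fin 2) ℂ) (hc : c.trace = 0) :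
    kerDProj F n K c₀ (expHermField (F := F) (K := K)
      (fun b : PBond (F.P K) 0 =>
        (((s * (if (b.src b.dir).val % F.L = 0 then (1 : ℝ) else if (b.src b.dir).val % F.L = 1 then -1 else 0)) : ℝ) : ℂ) •
          spinHalfPauli b.dir)) (toL2S F K c₀ (fun _ => c)) = 0 :=
  kerDProj_eq_zero_of_mem_orthogonal _ (toL2S_const_mem_ker_DL2_orthogonal n s hs0 hs c hc)

/-- **THE LEFT SIDE OF THE ℓ¹-POINCARÉ INEQUALITY AT A TRACELESS CONSTANT**: `Σ_x ‖c − (P₀ c)(x)‖ = #sites · ‖c‖` (`P₀ c = 0`).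
[cite: Balaban1985BackgroundPropagators, (3.24) p.394, Prop. 3.3 p.397] -/
theorem sum_norm_const_sub_kerDProj (n : ℕ) [Fact (0 < c₀)] (s : ℝ) (hs0 : 0 < s) (hs : s ≤ 1) (c : Matrix (Fin 2) (Fin 2) ℂ) (hc : c.trace = 0) :
    ∑ x : Site (F.P K) 0, ‖((fun _ : Site (F.P K) 0 => c) - (toL2S F K c₀).symm (kerDProj F n K c₀ (expHermField (F := F) (K := K)
      (fun b : PBond (F.P K) 0 =>
        (((s * (if (b.src b.dir).val % F.L = 0 then (1 : ℝ) else if (b.src b.dir).val % F.L = 1 then -1 else 0)) : ℝ) : ℂ) •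
          spinHalfPauli b.dir)) (toL2S F K c₀ (fun _ => c)))) x‖ = Fintype.card (Site (F.P K) 0) * ‖c‖ := by
  rw [kerDProj_toL2S_const_eq_zero n s hs0 hs c hc, map_zero, sub_zero]
  simp

/-- **THE RIGHT SIDE OF THE ℓ¹-POINCARÉ INEQUALITY AT A CONSTANT**: `Σ_b ‖(D_{U_s} c)(b)‖ ≤ #bonds · 2 s L^{K−n} ‖c‖` (px13 g10 ✓`Prop7HPcolNegConstantMode.norm_toL2_symm_DL2_toL2S_const_le`
and ✓`Prop7HPcolNegLowMode.norm_field_sub_one_le`, `‖U_s(b) − 1‖ ≤ s`). [cite: Balaban1985BackgroundPropagators, (3.3) p.391, (3.19) p.393] -/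
theorem sum_norm_DL2_const_le (n : ℕ) [Fact (0 < c₀)] (s : ℝ) (hs0 : 0 ≤ s) (c : Matrix (Fin 2) (Fin 2) ℂ) :
    ∑ b : PBond (F.P K) 0, ‖(toL2 F K c₀).symm (DL2 F n K c₀ (expHermField (F := F) (K := K)
      (fun b : PBond (F.P K) 0 =>
        (((s * (if (b.src b.dir).val % F.L = 0 then (1 : ℝ) else if (b.src b.dir).val % F.L = 1 then -1 else 0)) : ℝ) : ℂ) •
          spinHalfPauli b.dir)) (toL2S F K c₀ (fun _ => c))) b‖
      ≤ Fintype.card (PBond (F.P K) 0) * (2 * s * (F.L : ℝ) ^ (K - n) * ‖c‖) := by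
  have hL : (0 : ℝ) ≤ (F.L : ℝ) ^ (K - n) * ‖c‖ := by positivity
  have h : ∀ b : PBond (F.P K) 0, ‖(toL2 F K c₀).symm (DL2 F n K c₀ (expHermField (F := F) (K := K)
      (fun b : PBond (F.P K) 0 =>
        (((s * (if (b.src b.dir).val % F.L = 0 then (1 : ℝ) else if (b.src b.dir).val % F.L = 1 then -1 else 0)) : ℝ) : ℂ) •
          spinHalfPauli b.dir)) (toL2S F K c₀ (fun _ => c))) b‖ ≤ 2 * s * (F.L : ℝ) ^ (K - n) * ‖c‖ := by
    intro b
    refine le_trans (norm_toL2_symm_DL2_toL2S_const_le F (n := n) _ c b) ?_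
    have hb := norm_field_sub_one_le F K s hs0 b
    nlinarith [mul_le_mul_of_nonneg_right hb hL]
  calc _ ≤ ∑ _b : PBond (F.P K) 0, 2 * s * (F.L : ℝ) ^ (K - n) * ‖c‖ := Finset.sum_le_sum fun b _ => h b
    _ = _ := by rw [Finset.sum_const, Finset.card_univ, nsmul_eq_mul]

/-! ## §2 The headline: SPEC-0 N6, the `hPcol` binder of S42ᴸ (✓p729698 :185–188) VERBATIM under `¬` -/

/-- ★★★ **NEG-hPcol — THE S42ᴸ DISPLAY ROW `hPcol` IS NOT INHABITABLE** (SPEC-0 N6; the row text is ✓p729698 :185–188 verbatim, its constants `αcap, c₀, cB, a, p139` universally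
bound with the display's own side conditions `αcap > 0` on `L > 1`, `c₀, cB > 0`, `a > 0`).  Witness: px12 g11's explicit stratum-(c) family `U_s` on the member `(F, n, K) = (⟨3, 1⟩, 0, 1)`
at one small `s > 0` — regular (N3c), block average trivial (N3b) so the constant `σ₃ ∈ N_S(U_s)` (N4), irreducible (N5) so `P₀ σ₃ = 0`, whence the ℓ¹-Poincaré inequality (P1) forced by
the row reads `#sites ≤ p139 L · 3 #sites · 2sL ≤ #sites∕2`.  NEGATIVE KNOWLEDGE OF RECORD (TARGET.md footnote 17v), not an item refutation, not a display event.
[cite: Balaban1985BackgroundPropagators, (3.19)–(3.24) pp.393–394, Prop. 3.3 p.397; Balaban1987RG1, (0.1) p.251, (0.4) p.253; Balaban1985Variational, Thm 1 p.279] -/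
theorem not_hPcol_S42L
    (αcap : ℕ → ℝ) (hαcap : ∀ L : ℕ, 1 < L → 0 < αcap L)
    (c₀ cB : ℕ → ℝ) [hc₀ : ∀ L : ℕ, Fact (0 < c₀ L)] [hcB : ∀ L : ℕ, Fact (0 < cB L)]
    (a : ∀ L : ℕ, Idx L → ℝ) (ha : ∀ (L : ℕ) (i : Idx L), 0 < a L i) (p139 : ℕ → ℝ) :
    ¬ (∀ (L : ℕ), 1 < L → ∀ (i : Idx L) (U₀ : GaugeField (i.1.1.P i.1.2.2) 0 (Matrix.specialUnitaryGroup (Fin 2) ℂ)), ∀ ρ : ℝ, RegPr i.1.1 i.1.2.1 i.1.2.2 ρ U₀ → ρ ≤ αcap L →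
      ∀ (bd : PBond (i.1.1.P i.1.2.2) 0) (E : Matrix (Fin 2) (Fin 2) ℂ),
        ∑ x : Site (i.1.1.P i.1.2.2) 0, ‖(toL2S i.1.1 i.1.2.2 (c₀ L)).symm (GprimeP i.1.1 i.1.2.1 i.1.2.2 i.2.2.le (c₀ L) (cB L) (a L i) U₀
          (RS i.1.1 i.1.2.1 i.1.2.2 i.2.2.le (c₀ L) (cB L) U₀ (DstarL2 i.1.1 i.1.2.1 i.1.2.2 (c₀ L) U₀ (toL2 i.1.1 i.1.2.2 (c₀ L) (Pi.single bd E))))) x‖ ≤ p139 L * ‖E‖) := by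
  intro hP
  -- THE MEMBER: any `T3Family` (`L = 3`, `m = 1`), unit level `n = 0`, fine level `K = 1`
  obtain ⟨F⟩ : Nonempty T3Family := ⟨⟨3, ⟨⟨1, by norm_num⟩, by norm_num⟩, 1, le_rfl⟩⟩
  have hL1 : 1 < F.L := F.hL.2
  have hL0 : 0 < F.L := lt_trans Nat.zero_lt_one hL1
  have hL : (0 : ℝ) < F.L := by exact_mod_cast hL0
  -- THE CONSTANTS at this member: `ρ = αcap L`, `ε₀ = (10¹² L³)⁻¹`, `p⁺ = max (p139 L) 0`
  have hρ : 0 < αcap F.L := hαcap F.L hL1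
  have hε₀ : (0 : ℝ) < (10 ^ 12 * (F.L : ℝ) ^ 3)⁻¹ := by positivity
  have hWε : 10 ^ 12 * (F.L : ℝ) ^ 3 * (10 ^ 12 * (F.L : ℝ) ^ 3)⁻¹ ≤ 1 := (mul_inv_cancel₀ (by positivity)).le
  set q : ℝ := max (p139 F.L) 0 with hq
  have hq0 : 0 ≤ q := le_max_right _ _
  have hpq : p139 F.L ≤ q := le_max_left _ _
  -- THE SMALL PARAMETER `s`
  have hA : (0 : ℝ) < 1 / (40 * (F.L : ℝ)) := by positivity
  have hB : (0 : ℝ) < αcap F.L * ((F.L : ℝ)⁻¹) ^ (3 * (1 - 0)) / 48 := by positivity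
  have hC : (0 : ℝ) < (10 ^ 12 * (F.L : ℝ) ^ 3)⁻¹ * ((F.L : ℝ)⁻¹) ^ (3 * (1 - 0)) / 48 := by positivity
  have hD : (0 : ℝ) < 1 / (12 * (q + 1) * (F.L : ℝ)) := by positivity
  obtain ⟨s, hs0, hs40, hsB, hsC, hsD⟩ : ∃ s : ℝ, 0 < s ∧ s ≤ 1 / (40 * (F.L : ℝ)) ∧ s ≤ αcap F.L * ((F.L : ℝ)⁻¹) ^ (3 * (1 - 0)) / 48 ∧
      s ≤ (10 ^ 12 * (F.L : ℝ) ^ 3)⁻¹ * ((F.L : ℝ)⁻¹) ^ (3 * (1 - 0)) / 48 ∧ s ≤ 1 / (12 * (q + 1) * (F.L : ℝ)) :=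
    ⟨_, lt_min (lt_min (lt_min hA hB) hC) hD, le_trans (min_le_left _ _) (le_trans (min_le_left _ _) (min_le_left _ _)),
      le_trans (min_le_left _ _) (le_trans (min_le_left _ _) (min_le_right _ _)), le_trans (min_le_left _ _) (min_le_right _ _),
      min_le_right _ _⟩
  have hsρ : 48 * s ≤ αcap F.L * ((F.L : ℝ)⁻¹) ^ (3 * (1 - 0)) := by linarith
  have hsε : 48 * s ≤ (10 ^ 12 * (F.L : ℝ) ^ 3)⁻¹ * ((F.L : ℝ)⁻¹) ^ (3 * (1 - 0)) := by linarith
  have hs1 : s ≤ 1 := by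
    refine hs40.trans ?_
    rw [div_le_one (by positivity)]
    have : (1 : ℝ) ≤ F.L := by exact_mod_cast hL0
    linarith
  have hsq : 12 * (q + 1) * (F.L : ℝ) * s ≤ 1 := by
    have hDpos : (0 : ℝ) < 12 * (q + 1) * (F.L : ℝ) := by positivity
    have := (le_div_iff₀ hDpos).1 hsD
    linarith
  -- (N3c) the member is printed-regular at `ρ = αcap L` (the row's guard) and at `ε₀`
  have hreg := regPr_field_of_le F 1 0 hρ hs0.le hsρ
  have hregε := regPr_field_of_le F 1 0 hε₀ hs0.le hsε
  -- (hPcol) AT THIS MEMBER AND BACKGROUND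
  have hcol := hP F.L hL1 ⟨(F, 0, 1), rfl, Nat.zero_lt_one⟩ _ _ hreg le_rfl
  -- (N3b) + (N4): the constant `σ₃` lies in `N_S(U_s)`
  have hlam := toL2S_const_mem_NS F (Nat.zero_le 1) (c₀ := c₀ F.L) (cB F.L) hε₀ hWε _ hregε default
    (fun y w => holT_emb_field_eq F 1 s y default w) (fun j hj => spec_emlIterU_field_eq_one F 1 s hs0.le hs40 j hj) Nat.zero_lt_one
    (spinHalfPauli 2)
  -- (P1) the ℓ¹-Poincaré inequality forced by the columns, at `λ ≡ σ₃`
  have hP1 := l1_sub_kerDProj_le_of_columns (ha F.L ⟨(F, 0, 1), rfl, Nat.zero_lt_one⟩).le _ (p139 F.L) hcol (fun _ => spinHalfPauli 2) hlam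
  -- the two sides
  rw [sum_norm_const_sub_kerDProj (F := F) (K := 1) (c₀ := c₀ F.L) 0 s hs0 hs1 (spinHalfPauli 2) (trace_spinHalfPauli 2),
    norm_spinHalfPauli, mul_one] at hP1
  have hS := sum_norm_DL2_const_le (F := F) (K := 1) (c₀ := c₀ F.L) 0 s hs0.le (spinHalfPauli 2)
  rw [norm_spinHalfPauli, mul_one, Nat.sub_zero, pow_one] at hS
  have hS0 : (0 : ℝ) ≤ ∑ b : PBond (F.P 1) 0, ‖(toL2 F 1 (c₀ F.L)).symm (DL2 F 0 1 (c₀ F.L) (expHermField (F := F) (K := 1)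
      (fun b : PBond (F.P 1) 0 =>
        (((s * (if (b.src b.dir).val % F.L = 0 then (1 : ℝ) else if (b.src b.dir).val % F.L = 1 then -1 else 0)) : ℝ) : ℂ) •
          spinHalfPauli b.dir)) (toL2S F 1 (c₀ F.L) (fun _ => spinHalfPauli 2))) b‖ := Finset.sum_nonneg fun _ _ => norm_nonneg _
  -- the counts
  have hcard : (Fintype.card (PBond (F.P 1) 0) : ℝ) = 3 * Fintype.card (Site (F.P 1) 0) := by
    rw [card_pbond, T3Family.P_d]; push_cast; ring
  have hC1 : (1 : ℝ) ≤ Fintype.card (Site (F.P 1) 0) := by exact_mod_cast Fintype.card_pos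
  have hC0 : (0 : ℝ) ≤ Fintype.card (Site (F.P 1) 0) := zero_le_one.trans hC1
  -- `#sites ≤ p · Σ_b ≤ p⁺ · 3 #sites · 2sL ≤ #sites ∕ 2`
  have key : (Fintype.card (Site (F.P 1) 0) : ℝ) ≤ Fintype.card (Site (F.P 1) 0) / 2 :=
    calc (Fintype.card (Site (F.P 1) 0) : ℝ) ≤ _ := hP1
      _ ≤ q * _ := mul_le_mul_of_nonneg_right hpq hS0
      _ ≤ q * (Fintype.card (PBond (F.P 1) 0) * (2 * s * (F.L : ℝ))) := mul_le_mul_of_nonneg_left hS hq0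
      _ = q * (6 * s * (F.L : ℝ) * Fintype.card (Site (F.P 1) 0)) := by rw [hcard]; ring
      _ ≤ (q + 1) * (6 * s * (F.L : ℝ) * Fintype.card (Site (F.P 1) 0)) :=
          mul_le_mul_of_nonneg_right (by linarith) (by positivity)
      _ = (12 * (q + 1) * (F.L : ℝ) * s) * Fintype.card (Site (F.P 1) 0) / 2 := by ring
      _ ≤ 1 * Fintype.card (Site (F.P 1) 0) / 2 := by
          have := mul_le_mul_of_nonneg_right hsq hC0
          linarith
      _ = Fintype.card (Site (F.P 1) 0) / 2 := by ring
  linarith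

end Summit.QuantumFields.YangMills.Theorems.Prop7HPcolRowS42LNotInhabitable

end
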